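import Summits.HodgeConjecture.HodgeConjecture.Theses.AdelicCoherence
import Summits.HodgeConjecture.HodgeConjecture.Theorems.BoundaryReadoutHCOverNumberFieldsTransfer
import Literature.AlgebraicGeometry.Motives.CurveNet

/-!
# Route AdelicCoherence — `NumberFieldReduction` (support item stmt-HodgeConjecture-13520)

The Hodge conjecture for the complex base changes of smooth projective varieties over NUMBER FIELDS
implies it for the complex base changes of smooth projective varieties over `ℚ̄`: `X₀ ×_{ℚ̄,σ} ℂ` smooth
projective ⟹ `X₀` smooth projective over `ℚ̄` (descent, `isSmoothProjective_of_baseChangeHom`) ⟹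
`X₀ ≅ X₁ ×_{K,ι} ℚ̄` for a number field `K` (EGA IV₃ 8.8.2 (ii), the tree's `stub_numberFieldModel`) ⟹
`X₀ ×_σ ℂ ≅ X₁ ×_{K,σ∘ι} ℂ` (transitivity of base change, `iso_baseChangeHom_comp_of_rigid`), along
which smooth-projectivity (`IsSmoothProjective.of_iso`, and descent to `K`) and the Hodge conjecture
(`hodgeConjectureFor_transport_of_iso`) are transported.  The same steps as the tree's
`hodgeConjectureQbar_of_hcOverNumberFields`, for this route's spelling of the hypothesis.  No
named-fact hypothesis, no sorry.
-/

-- `Summit.HodgeConjecture.HodgeConjecture.Theorems` is the mandated namespace (single-problem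
-- summit: Problem = Summit), which `linter.dupNamespace` flags on every declaration; the lakefile
-- turns the linter off tree-wide (weak option), restated here so stand-alone elaboration is
-- warning-free too.
set_option linter.dupNamespace false

namespace Summit.HodgeConjecture.HodgeConjecture.Theorems

open CategoryTheory Literature.AlgebraicGeometry.Motives Literature.AlgebraicGeometry.HodgeTheory
open Summit.HodgeConjecture.HodgeConjecture.Theorems.QbarFibreAnchors (iso_baseChangeHom_comp_of_rigid)

/-- **Item stmt-HodgeConjecture-13520 (`NumberFieldReduction`), route `AdelicCoherence`**: descend
`X₀/ℚ̄` to a number-field model and transport the Hodge conjecture along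
`X₀ ×_σ ℂ ≅ X₁ ×_{σ∘ι} ℂ`. [cite: EGAIV3, Thm. 8.8.2 (ii)] [cite: GortzWedhorn2020, Prop. 10.75] -/
theorem adelicCoherence_numberFieldReduction_proof :
    Summit.HodgeConjecture.HodgeConjecture.Theses.AdelicCoherence.NumberFieldReduction := by
  intro hNF σ n X₀ hX
  have hX₀ : IsSmoothProjective n X₀ := isSmoothProjective_of_baseChangeHom σ X₀ hX
  obtain ⟨K, _, _, ι, X₁, ⟨e₁⟩⟩ := stub_numberFieldModel X₀ hX₀
  obtain ⟨e₂⟩ := iso_baseChangeHom_comp_of_rigid ι σ X₁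
  let e : (baseChangeHom σ).obj X₀ ≅ (baseChangeHom (σ.comp ι)).obj X₁ :=
    (baseChangeHom σ).mapIso e₁ ≪≫ e₂
  have hX₁ℂ : IsSmoothProjective n ((baseChangeHom (σ.comp ι)).obj X₁) :=
    IsSmoothProjective.of_iso e hX
  have hX₁ : IsSmoothProjective n X₁ := isSmoothProjective_of_baseChangeHom (σ.comp ι) X₁ hX₁ℂ
  exact hodgeConjectureFor_transport_of_iso e (hNF (σ.comp ι) hX₁ hX₁ℂ)

end Summit.HodgeConjecture.HodgeConjecture.Theorems
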